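import Mathlib.Topology.Algebra.RestrictedProduct.TopologicalSpace
import Mathlib.Topology.Algebra.ContinuousMonoidHom
import HarnessLib

/-!
# Restricted products of binary products: `Πʳ i, [A i × B i, C i × D i] ≃ₜ* (Πʳ i, [A i, C i]) × (Πʳ i, [B i, D i])`

Topic `Topology`; namespace `Literature.Topology.RestrictedProduct`. DEFINITIONS with bodies (the
maps, the equivalence, the homeomorphism, the topological-group isomorphism) and proved lemmas; no
named fact, no instance, no notation, no `sorry`.

For Mathlib's restricted product `Πʳ i, [R i, A i]_[𝓕]` (`RestrictedProduct`): the restricted product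
of a family of binary products `A i × B i` with respect to «box» subsets `E i` with
`E i = C i ×ˢ D i` (stated as the three inclusions `fst(E i) ⊆ C i`, `snd(E i) ⊆ D i`,
`C i ×ˢ D i ⊆ E i`, so that both the set-product `C i ×ˢ D i` and the coercion of a subgroup product
`(C i).prod (D i)` are instances) is the binary product of the restricted products:

* §1 (any filter) the maps `prodFst`, `prodSnd` (`RestrictedProduct.map` along the projections),
  `prodMk`, and the bijection `prodEquiv` — the tree's ★ `Equiv.restrictedProductProd`
  (`NumberTheory/AdelicBaseChange/RestrictedProductEquivs`, vendored from the FLT project, stated for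
  the literal family `C i ×ˢ D i`) in the three-inclusion form; `continuous_prodFst/Snd`
  (`RestrictedProduct.mapAlong_continuous`);
* §2 (filter `cofinite`, all `C i`, `D i` OPEN) `continuous_prodMk` — by Mathlib's universal property
  with parameters `RestrictedProduct.continuous_dom_prod` («the key result for continuity of
  multiplication») and `continuous_rng_of_principal` on the principal stages — and the HOMEOMORPHISM
  **`prodHomeomorph`**;
* §3 (groups, open subgroups `C i ≤ A i`, `D i ≤ B i`) the topological-group isomorphism
  **`prodContinuousMulEquiv : Πʳ i, [A i × B i, (C i).prod (D i)] ≃ₜ* (Πʳ i, [A i, C i]) × (Πʳ i, [B i, D i])`**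
  (multiplicativity is componentwise, `rfl`), with `_apply_fst/_apply_snd/_symm_apply`;
* §4 the riders `ContinuousMulEquiv.prodCongr` (`M₁ × M₂ ≃ₜ* N₁ × N₂` from factor isomorphisms) and
  `ContinuousMulEquiv.prodProdProdComm'` (`(G₁ × G₂) × (G₃ × G₄) ≃ₜ* (G₁ × G₃) × (G₂ × G₄)`, Mathlib's
  `MulEquiv.prodProdProdComm` + `Homeomorph.prodProdProdComm` glued).

Use (cell `pub/hodgecm-mathlib`, ENGINE T1, row «C-H»): the finite-adelic points of the endoscopic
group `H = U(Φ₂) × U(Φ₁)` as ONE restricted product `Πʳ_v [U(Φ₂)_v × U(Φ₁)_v ; K₂,v × K₁,v]`, so that the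
generic «orbital measure from local ones» glue (★ `Automorphic/OrbitalMeasureOfLocal`, model
`e : G_f ≃ₜ* Πʳ i [G i, K i]`) applies verbatim to the product datum
(Borel–Jacquet (1979) §4.1: `G(𝔸_f) = ∏'_v G(F_v)` for any linear algebraic `G`, in particular a product).

## References
* A. Borel, H. Jacquet, *Automorphic forms and automorphic representations*, PSPM 33.1 (1979), §4.1
  (restricted products of local groups) [BorelJacquet1979].
* The FLT project, `FLT/Mathlib/Topology/Algebra/RestrictedProduct/Equiv.lean`
  (`Equiv.restrictedProductProd`) [FLTProject2025].
* N. Bourbaki, *General Topology*, Ch. I §4 (final topologies; the inductive-limit topology) [folklore].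
-/

open Set Filter Topology Function
open scoped RestrictedProduct

namespace Literature.Topology.RestrictedProduct

universe u v v' w

/-! ## §1 The maps and the bijection (any filter) -/

section Maps

variable {ι : Type u} {𝓕 : Filter ι} {A : ι → Type v} {B : ι → Type v'}
  {C : ∀ i, Set (A i)} {D : ∀ i, Set (B i)} {E : ∀ i, Set (A i × B i)}

/-- **First projection** `Πʳ [A i × B i, E i] → Πʳ [A i, C i]` (componentwise `Prod.fst`), for box
sets with `fst (E i) ⊆ C i`. [cite: FLTProject2025, FLT/Mathlib/Topology/Algebra/RestrictedProduct/Equiv.lean · Equiv.restrictedProductProd] -/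
def prodFst (h₁ : ∀ i, MapsTo Prod.fst (E i) (C i)) (x : Πʳ i, [A i × B i, E i]_[𝓕]) :
    Πʳ i, [A i, C i]_[𝓕] :=
  RestrictedProduct.map (fun i => (Prod.fst : A i × B i → A i)) (Eventually.of_forall h₁) x

/-- **Second projection** `Πʳ [A i × B i, E i] → Πʳ [B i, D i]` (componentwise `Prod.snd`).
[cite: FLTProject2025, FLT/Mathlib/Topology/Algebra/RestrictedProduct/Equiv.lean · Equiv.restrictedProductProd] -/
def prodSnd (h₂ : ∀ i, MapsTo Prod.snd (E i) (D i)) (x : Πʳ i, [A i × B i, E i]_[𝓕]) :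
    Πʳ i, [B i, D i]_[𝓕] :=
  RestrictedProduct.map (fun i => (Prod.snd : A i × B i → B i)) (Eventually.of_forall h₂) x

/-- **Pairing** `(Πʳ [A i, C i]) × (Πʳ [B i, D i]) → Πʳ [A i × B i, E i]` (componentwise pairs), for box
sets with `C i ×ˢ D i ⊆ E i`. [cite: FLTProject2025, FLT/Mathlib/Topology/Algebra/RestrictedProduct/Equiv.lean · Equiv.restrictedProductProd] -/
def prodMk (h : ∀ i, ∀ a ∈ C i, ∀ b ∈ D i, (a, b) ∈ E i) (y : Πʳ i, [A i, C i]_[𝓕])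
    (z : Πʳ i, [B i, D i]_[𝓕]) : Πʳ i, [A i × B i, E i]_[𝓕] :=
  ⟨fun i => (y i, z i), by
    filter_upwards [y.2, z.2] with i hy hz using h i _ hy _ hz⟩

/-- Components of `prodFst`. [cite: FLTProject2025, FLT/Mathlib/Topology/Algebra/RestrictedProduct/Equiv.lean · Equiv.restrictedProductProd] -/
@[simp] theorem prodFst_apply (h₁ : ∀ i, MapsTo Prod.fst (E i) (C i)) (x : Πʳ i, [A i × B i, E i]_[𝓕])
    (i : ι) : prodFst h₁ x i = (x i).1 := rfl

/-- Components of `prodSnd`. [cite: FLTProject2025, FLT/Mathlib/Topology/Algebra/RestrictedProduct/Equiv.lean · Equiv.restrictedProductProd] -/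
@[simp] theorem prodSnd_apply (h₂ : ∀ i, MapsTo Prod.snd (E i) (D i)) (x : Πʳ i, [A i × B i, E i]_[𝓕])
    (i : ι) : prodSnd h₂ x i = (x i).2 := rfl

/-- Components of `prodMk`. [cite: FLTProject2025, FLT/Mathlib/Topology/Algebra/RestrictedProduct/Equiv.lean · Equiv.restrictedProductProd] -/
@[simp] theorem prodMk_apply (h : ∀ i, ∀ a ∈ C i, ∀ b ∈ D i, (a, b) ∈ E i) (y : Πʳ i, [A i, C i]_[𝓕])
    (z : Πʳ i, [B i, D i]_[𝓕]) (i : ι) : prodMk h y z i = (y i, z i) := rfl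

/-- **`Πʳ [A i × B i, E i] ≃ (Πʳ [A i, C i]) × (Πʳ [B i, D i])`** for box sets `E i = C i ×ˢ D i` (three
inclusions) — the tree's ★ `Equiv.restrictedProductProd` (FLT) in a form that also covers the coercion
of a product of subgroups. [cite: FLTProject2025, FLT/Mathlib/Topology/Algebra/RestrictedProduct/Equiv.lean · Equiv.restrictedProductProd] -/
def prodEquiv (h₁ : ∀ i, MapsTo Prod.fst (E i) (C i)) (h₂ : ∀ i, MapsTo Prod.snd (E i) (D i))
    (h : ∀ i, ∀ a ∈ C i, ∀ b ∈ D i, (a, b) ∈ E i) :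
    Πʳ i, [A i × B i, E i]_[𝓕] ≃ (Πʳ i, [A i, C i]_[𝓕]) × (Πʳ i, [B i, D i]_[𝓕]) where
  toFun x := (prodFst h₁ x, prodSnd h₂ x)
  invFun p := prodMk h p.1 p.2
  left_inv x := by ext i <;> rfl
  right_inv p := by ext i <;> rfl

/-- `prodEquiv` is the pair of projections. [cite: FLTProject2025, FLT/Mathlib/Topology/Algebra/RestrictedProduct/Equiv.lean · Equiv.restrictedProductProd] -/
@[simp] theorem prodEquiv_apply (h₁ : ∀ i, MapsTo Prod.fst (E i) (C i)) (h₂ : ∀ i, MapsTo Prod.snd (E i) (D i))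
    (h : ∀ i, ∀ a ∈ C i, ∀ b ∈ D i, (a, b) ∈ E i) (x : Πʳ i, [A i × B i, E i]_[𝓕]) :
    prodEquiv h₁ h₂ h x = (prodFst h₁ x, prodSnd h₂ x) := rfl

/-- `prodEquiv.symm` is the pairing. [cite: FLTProject2025, FLT/Mathlib/Topology/Algebra/RestrictedProduct/Equiv.lean · Equiv.restrictedProductProd] -/
@[simp] theorem prodEquiv_symm_apply (h₁ : ∀ i, MapsTo Prod.fst (E i) (C i))
    (h₂ : ∀ i, MapsTo Prod.snd (E i) (D i)) (h : ∀ i, ∀ a ∈ C i, ∀ b ∈ D i, (a, b) ∈ E i)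
    (p : (Πʳ i, [A i, C i]_[𝓕]) × (Πʳ i, [B i, D i]_[𝓕])) :
    (prodEquiv h₁ h₂ h).symm p = prodMk h p.1 p.2 := rfl

/-- The three inclusions hold for the literal box family `E i = C i ×ˢ D i` (first).
[cite: FLTProject2025, FLT/Mathlib/Topology/Algebra/RestrictedProduct/Equiv.lean · Equiv.restrictedProductProd] -/
theorem mapsTo_fst_prod (i : ι) : MapsTo Prod.fst (C i ×ˢ D i) (C i) := fun _ hx => hx.1

/-- (second) [cite: FLTProject2025, FLT/Mathlib/Topology/Algebra/RestrictedProduct/Equiv.lean · Equiv.restrictedProductProd] -/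
theorem mapsTo_snd_prod (i : ι) : MapsTo Prod.snd (C i ×ˢ D i) (D i) := fun _ hx => hx.2

/-- (third) [cite: FLTProject2025, FLT/Mathlib/Topology/Algebra/RestrictedProduct/Equiv.lean · Equiv.restrictedProductProd] -/
theorem mk_mem_prod_of_mem (i : ι) : ∀ a ∈ C i, ∀ b ∈ D i, (a, b) ∈ C i ×ˢ D i :=
  fun _ ha _ hb => mk_mem_prod ha hb

variable [∀ i, TopologicalSpace (A i)] [∀ i, TopologicalSpace (B i)]

/-- `prodFst` is continuous (any filter; `RestrictedProduct.mapAlong_continuous`). [cite: BorelJacquet1979, §4.1] -/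
theorem continuous_prodFst (h₁ : ∀ i, MapsTo Prod.fst (E i) (C i)) :
    Continuous (prodFst (𝓕 := 𝓕) h₁) :=
  RestrictedProduct.mapAlong_continuous (fun i => A i × B i) A id tendsto_id
    (fun i => (Prod.fst : A i × B i → A i)) (Eventually.of_forall h₁) fun _ => continuous_fst

/-- `prodSnd` is continuous (any filter). [cite: BorelJacquet1979, §4.1] -/
theorem continuous_prodSnd (h₂ : ∀ i, MapsTo Prod.snd (E i) (D i)) :
    Continuous (prodSnd (𝓕 := 𝓕) h₂) :=
  RestrictedProduct.mapAlong_continuous (fun i => A i × B i) B id tendsto_id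
    (fun i => (Prod.snd : A i × B i → B i)) (Eventually.of_forall h₂) fun _ => continuous_snd

/-- `prodEquiv` is continuous (any filter). [cite: BorelJacquet1979, §4.1] -/
theorem continuous_prodEquiv (h₁ : ∀ i, MapsTo Prod.fst (E i) (C i)) (h₂ : ∀ i, MapsTo Prod.snd (E i) (D i))
    (h : ∀ i, ∀ a ∈ C i, ∀ b ∈ D i, (a, b) ∈ E i) :
    Continuous (prodEquiv (𝓕 := 𝓕) h₁ h₂ h) :=
  (continuous_prodFst h₁).prodMk (continuous_prodSnd h₂)

/-- On a PRINCIPAL stage the pairing is continuous (the principal restricted product carries the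
subspace topology of the full product, `RestrictedProduct.continuous_rng_of_principal`).
[cite: BorelJacquet1979, §4.1] -/
theorem continuous_prodMk_principal (h : ∀ i, ∀ a ∈ C i, ∀ b ∈ D i, (a, b) ∈ E i) (S : Set ι) :
    Continuous (fun p : (Πʳ i, [A i, C i]_[𝓟 S]) × (Πʳ i, [B i, D i]_[𝓟 S]) => prodMk h p.1 p.2) := by
  refine RestrictedProduct.continuous_rng_of_principal.2 (continuous_pi fun i => ?_)
  exact ((RestrictedProduct.continuous_eval i).comp continuous_fst).prodMk
    ((RestrictedProduct.continuous_eval i).comp continuous_snd)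

end Maps

/-! ## §2 The homeomorphism (filter `cofinite`, open box sets) -/

section Homeomorph

variable {ι : Type u} {A : ι → Type v} {B : ι → Type v'} [∀ i, TopologicalSpace (A i)] [∀ i, TopologicalSpace (B i)]
  {C : ∀ i, Set (A i)} {D : ∀ i, Set (B i)} {E : ∀ i, Set (A i × B i)}

/-- **The pairing `(y, z) ↦ (i ↦ (y i, z i))` is continuous** for OPEN `C i`, `D i` (filter `cofinite`):
by Mathlib's universal property with parameters `RestrictedProduct.continuous_dom_prod` it suffices to
check it on the principal stages `Πʳ[𝓟 S] × Πʳ[𝓟 S]`, where it factors through the principal stage of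
the target (`continuous_prodMk_principal`) followed by the continuous inclusion.
[cite: BorelJacquet1979, §4.1] -/
theorem continuous_prodMk (hC : ∀ i, IsOpen (C i)) (hD : ∀ i, IsOpen (D i))
    (h : ∀ i, ∀ a ∈ C i, ∀ b ∈ D i, (a, b) ∈ E i) :
    Continuous (fun p : (Πʳ i, [A i, C i]) × (Πʳ i, [B i, D i]) => prodMk h p.1 p.2) := by
  refine (RestrictedProduct.continuous_dom_prod hC hD).2 fun S hS => ?_
  have key : (fun p : (Πʳ i, [A i, C i]) × (Πʳ i, [B i, D i]) => prodMk h p.1 p.2) ∘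
      Prod.map (RestrictedProduct.inclusion A C hS) (RestrictedProduct.inclusion B D hS) =
      RestrictedProduct.inclusion (fun i => A i × B i) E hS ∘
        fun p : (Πʳ i, [A i, C i]_[𝓟 S]) × (Πʳ i, [B i, D i]_[𝓟 S]) => prodMk h p.1 p.2 := rfl
  rw [key]
  exact (RestrictedProduct.continuous_inclusion hS).comp (continuous_prodMk_principal h S)

/-- `prodEquiv.symm` is continuous (filter `cofinite`, open box sets). [cite: BorelJacquet1979, §4.1] -/
theorem continuous_prodEquiv_symm (hC : ∀ i, IsOpen (C i)) (hD : ∀ i, IsOpen (D i))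
    (h₁ : ∀ i, MapsTo Prod.fst (E i) (C i)) (h₂ : ∀ i, MapsTo Prod.snd (E i) (D i))
    (h : ∀ i, ∀ a ∈ C i, ∀ b ∈ D i, (a, b) ∈ E i) :
    Continuous (prodEquiv (𝓕 := cofinite) h₁ h₂ h).symm :=
  continuous_prodMk hC hD h

/-- **`Πʳ i, [A i × B i, E i] ≃ₜ (Πʳ i, [A i, C i]) × (Πʳ i, [B i, D i])`** for OPEN `C i`, `D i` and box sets
`E i = C i ×ˢ D i` (three inclusions), filter `cofinite`. [cite: BorelJacquet1979, §4.1] -/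
def prodHomeomorph (hC : ∀ i, IsOpen (C i)) (hD : ∀ i, IsOpen (D i))
    (h₁ : ∀ i, MapsTo Prod.fst (E i) (C i)) (h₂ : ∀ i, MapsTo Prod.snd (E i) (D i))
    (h : ∀ i, ∀ a ∈ C i, ∀ b ∈ D i, (a, b) ∈ E i) :
    Πʳ i, [A i × B i, E i] ≃ₜ (Πʳ i, [A i, C i]) × (Πʳ i, [B i, D i]) where
  toEquiv := prodEquiv h₁ h₂ h
  continuous_toFun := continuous_prodEquiv h₁ h₂ h
  continuous_invFun := continuous_prodEquiv_symm hC hD h₁ h₂ h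

/-- `prodHomeomorph` is the pair of projections. [cite: BorelJacquet1979, §4.1] -/
@[simp] theorem prodHomeomorph_apply (hC : ∀ i, IsOpen (C i)) (hD : ∀ i, IsOpen (D i))
    (h₁ : ∀ i, MapsTo Prod.fst (E i) (C i)) (h₂ : ∀ i, MapsTo Prod.snd (E i) (D i))
    (h : ∀ i, ∀ a ∈ C i, ∀ b ∈ D i, (a, b) ∈ E i) (x : Πʳ i, [A i × B i, E i]) :
    prodHomeomorph hC hD h₁ h₂ h x = (prodFst h₁ x, prodSnd h₂ x) := rfl

/-- `prodHomeomorph.symm` is the pairing. [cite: BorelJacquet1979, §4.1] -/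
@[simp] theorem prodHomeomorph_symm_apply (hC : ∀ i, IsOpen (C i)) (hD : ∀ i, IsOpen (D i))
    (h₁ : ∀ i, MapsTo Prod.fst (E i) (C i)) (h₂ : ∀ i, MapsTo Prod.snd (E i) (D i))
    (h : ∀ i, ∀ a ∈ C i, ∀ b ∈ D i, (a, b) ∈ E i)
    (p : (Πʳ i, [A i, C i]) × (Πʳ i, [B i, D i])) :
    (prodHomeomorph hC hD h₁ h₂ h).symm p = prodMk h p.1 p.2 := rfl

/-- The homeomorphism for the LITERAL box family `C i ×ˢ D i`. [cite: BorelJacquet1979, §4.1] -/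
def prodHomeomorph' (hC : ∀ i, IsOpen (C i)) (hD : ∀ i, IsOpen (D i)) :
    Πʳ i, [A i × B i, C i ×ˢ D i] ≃ₜ (Πʳ i, [A i, C i]) × (Πʳ i, [B i, D i]) :=
  prodHomeomorph hC hD mapsTo_fst_prod mapsTo_snd_prod mk_mem_prod_of_mem

end Homeomorph

/-! ## §3 The topological-group isomorphism (open subgroups) -/

section Group

variable {ι : Type u} {A : ι → Type v} {B : ι → Type v'} [∀ i, Group (A i)] [∀ i, Group (B i)]
  (C : ∀ i, Subgroup (A i)) (D : ∀ i, Subgroup (B i))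

/-- For subgroups, `fst ((C i).prod (D i)) ⊆ C i`. [cite: BorelJacquet1979, §4.1] -/
theorem mapsTo_fst_coe_prod (i : ι) :
    MapsTo Prod.fst (((C i).prod (D i) : Subgroup (A i × B i)) : Set (A i × B i)) (C i : Set (A i)) :=
  fun _ hx => (Subgroup.mem_prod.1 hx).1

/-- `snd ((C i).prod (D i)) ⊆ D i`. [cite: BorelJacquet1979, §4.1] -/
theorem mapsTo_snd_coe_prod (i : ι) :
    MapsTo Prod.snd (((C i).prod (D i) : Subgroup (A i × B i)) : Set (A i × B i)) (D i : Set (B i)) :=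
  fun _ hx => (Subgroup.mem_prod.1 hx).2

/-- `C i ×ˢ D i ⊆ (C i).prod (D i)`. [cite: BorelJacquet1979, §4.1] -/
theorem mk_mem_coe_prod_of_mem (i : ι) :
    ∀ a ∈ (C i : Set (A i)), ∀ b ∈ (D i : Set (B i)),
      (a, b) ∈ (((C i).prod (D i) : Subgroup (A i × B i)) : Set (A i × B i)) :=
  fun _ ha _ hb => Subgroup.mem_prod.2 ⟨ha, hb⟩

/-- **`Πʳ i, [A i × B i, (C i).prod (D i)] ≃* (Πʳ i, [A i, C i]) × (Πʳ i, [B i, D i])`** (any filter;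
multiplication is componentwise on both sides). [cite: BorelJacquet1979, §4.1] -/
def prodMulEquiv {𝓕 : Filter ι} :
    Πʳ i, [A i × B i, ((C i).prod (D i) : Subgroup (A i × B i))]_[𝓕] ≃*
      (Πʳ i, [A i, C i]_[𝓕]) × (Πʳ i, [B i, D i]_[𝓕]) where
  toEquiv := prodEquiv (mapsTo_fst_coe_prod C D) (mapsTo_snd_coe_prod C D) (mk_mem_coe_prod_of_mem C D)
  map_mul' _ _ := by ext i <;> rfl

/-- `prodMulEquiv` is the pair of projections. [cite: BorelJacquet1979, §4.1] -/
@[simp] theorem prodMulEquiv_apply {𝓕 : Filter ι}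
    (x : Πʳ i, [A i × B i, ((C i).prod (D i) : Subgroup (A i × B i))]_[𝓕]) :
    prodMulEquiv C D x = (prodFst (mapsTo_fst_coe_prod C D) x, prodSnd (mapsTo_snd_coe_prod C D) x) := rfl

/-- `prodMulEquiv.symm` is the pairing. [cite: BorelJacquet1979, §4.1] -/
@[simp] theorem prodMulEquiv_symm_apply {𝓕 : Filter ι}
    (p : (Πʳ i, [A i, C i]_[𝓕]) × (Πʳ i, [B i, D i]_[𝓕])) :
    (prodMulEquiv C D).symm p = prodMk (mk_mem_coe_prod_of_mem C D) p.1 p.2 := rfl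

variable [∀ i, TopologicalSpace (A i)] [∀ i, TopologicalSpace (B i)]

/-- **`Πʳ i, [A i × B i, (C i).prod (D i)] ≃ₜ* (Πʳ i, [A i, C i]) × (Πʳ i, [B i, D i])`** — the restricted
product of the products `A i × B i` along the OPEN subgroups `C i × D i` is the product of the
restricted products, as a topological group (filter `cofinite`): e.g. `H(𝔸_f) = ∏'_v (G₂(F_v) × G₁(F_v))`
for `H = G₂ × G₁`. [cite: BorelJacquet1979, §4.1] -/
def prodContinuousMulEquiv (hC : ∀ i, IsOpen (C i : Set (A i))) (hD : ∀ i, IsOpen (D i : Set (B i))) :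
    Πʳ i, [A i × B i, ((C i).prod (D i) : Subgroup (A i × B i))] ≃ₜ*
      (Πʳ i, [A i, C i]) × (Πʳ i, [B i, D i]) where
  toMulEquiv := prodMulEquiv C D
  continuous_toFun := continuous_prodEquiv _ _ _
  continuous_invFun :=
    continuous_prodEquiv_symm hC hD (mapsTo_fst_coe_prod C D) (mapsTo_snd_coe_prod C D) (mk_mem_coe_prod_of_mem C D)

/-- `prodContinuousMulEquiv` is the pair of projections. [cite: BorelJacquet1979, §4.1] -/
@[simp] theorem prodContinuousMulEquiv_apply (hC : ∀ i, IsOpen (C i : Set (A i)))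
    (hD : ∀ i, IsOpen (D i : Set (B i))) (x : Πʳ i, [A i × B i, ((C i).prod (D i) : Subgroup (A i × B i))]) :
    prodContinuousMulEquiv C D hC hD x =
      (prodFst (mapsTo_fst_coe_prod C D) x, prodSnd (mapsTo_snd_coe_prod C D) x) := rfl

/-- `prodContinuousMulEquiv.symm` is the pairing. [cite: BorelJacquet1979, §4.1] -/
@[simp] theorem prodContinuousMulEquiv_symm_apply (hC : ∀ i, IsOpen (C i : Set (A i)))
    (hD : ∀ i, IsOpen (D i : Set (B i))) (p : (Πʳ i, [A i, C i]) × (Πʳ i, [B i, D i])) :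
    (prodContinuousMulEquiv C D hC hD).symm p = prodMk (mk_mem_coe_prod_of_mem C D) p.1 p.2 := rfl

/-- Componentwise reading: `(e x).1 i = (x i).1`. [cite: BorelJacquet1979, §4.1] -/
theorem prodContinuousMulEquiv_apply_fst_apply (hC : ∀ i, IsOpen (C i : Set (A i)))
    (hD : ∀ i, IsOpen (D i : Set (B i))) (x : Πʳ i, [A i × B i, ((C i).prod (D i) : Subgroup (A i × B i))])
    (i : ι) : (prodContinuousMulEquiv C D hC hD x).1 i = (x i).1 := rfl

/-- Componentwise reading: `(e x).2 i = (x i).2`. [cite: BorelJacquet1979, §4.1] -/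
theorem prodContinuousMulEquiv_apply_snd_apply (hC : ∀ i, IsOpen (C i : Set (A i)))
    (hD : ∀ i, IsOpen (D i : Set (B i))) (x : Πʳ i, [A i × B i, ((C i).prod (D i) : Subgroup (A i × B i))])
    (i : ι) : (prodContinuousMulEquiv C D hC hD x).2 i = (x i).2 := rfl

/-- Componentwise reading of the inverse: `(e⁻¹ (y, z)) i = (y i, z i)`. [cite: BorelJacquet1979, §4.1] -/
theorem prodContinuousMulEquiv_symm_apply_apply (hC : ∀ i, IsOpen (C i : Set (A i)))
    (hD : ∀ i, IsOpen (D i : Set (B i))) (p : (Πʳ i, [A i, C i]) × (Πʳ i, [B i, D i])) (i : ι) :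
    (prodContinuousMulEquiv C D hC hD).symm p i = (p.1 i, p.2 i) := rfl

end Group

end Literature.Topology.RestrictedProduct

/-! ## §4 Riders: `ContinuousMulEquiv.prodCongr` and `(G₁ × G₂) × (G₃ × G₄) ≃ₜ* (G₁ × G₃) × (G₂ × G₄)`

(Plain products, no restricted product: declared in the path namespace `Literature.Topology` — NOT in Mathlib's root
`ContinuousMulEquiv` namespace — so a future Mathlib `ContinuousMulEquiv.prodCongr` cannot clash; refer to them as
`Literature.Topology.ContinuousMulEquiv.prodCongr` / `…prodProdProdComm'` or `open Literature.Topology`.) -/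

namespace Literature.Topology

section ProdCongr

variable {M₁ M₂ N₁ N₂ : Type*} [MulOneClass M₁] [MulOneClass M₂] [MulOneClass N₁] [MulOneClass N₂]
  [TopologicalSpace M₁] [TopologicalSpace M₂] [TopologicalSpace N₁] [TopologicalSpace N₂]

/-- **`M₁ × M₂ ≃ₜ* N₁ × N₂` from `M₁ ≃ₜ* N₁` and `M₂ ≃ₜ* N₂`** (Mathlib's `MulEquiv.prodCongr` made continuous; the
tree's ★ `ContinuousMulEquiv.prodCongr'` in `MeasureTheory/Group/InvariantQuotientTorusMeasureTransport` is the same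
construction for groups — restated here Mathlib-generally so that this topology file imports no measure theory).
[cite: BorelJacquet1979, §4.1] -/
def ContinuousMulEquiv.prodCongr (e₁ : M₁ ≃ₜ* N₁) (e₂ : M₂ ≃ₜ* N₂) : M₁ × M₂ ≃ₜ* N₁ × N₂ :=
  { MulEquiv.prodCongr e₁.toMulEquiv e₂.toMulEquiv with
    continuous_toFun := (e₁.continuous.comp continuous_fst).prodMk (e₂.continuous.comp continuous_snd)
    continuous_invFun := (e₁.symm.continuous.comp continuous_fst).prodMk (e₂.symm.continuous.comp continuous_snd) }

/-- `prodCongr e₁ e₂ (a, b) = (e₁ a, e₂ b)`. [cite: BorelJacquet1979, §4.1] -/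
@[simp] theorem ContinuousMulEquiv.prodCongr_apply (e₁ : M₁ ≃ₜ* N₁) (e₂ : M₂ ≃ₜ* N₂) (p : M₁ × M₂) :
    ContinuousMulEquiv.prodCongr e₁ e₂ p = (e₁ p.1, e₂ p.2) := rfl

/-- `(prodCongr e₁ e₂).symm (a, b) = (e₁.symm a, e₂.symm b)`. [cite: BorelJacquet1979, §4.1] -/
@[simp] theorem ContinuousMulEquiv.prodCongr_symm_apply (e₁ : M₁ ≃ₜ* N₁) (e₂ : M₂ ≃ₜ* N₂) (p : N₁ × N₂) :
    (ContinuousMulEquiv.prodCongr e₁ e₂).symm p = (e₁.symm p.1, e₂.symm p.2) := rfl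

end ProdCongr

section Rider

variable (G₁ G₂ G₃ G₄ : Type*) [MulOneClass G₁] [MulOneClass G₂] [MulOneClass G₃] [MulOneClass G₄]
  [TopologicalSpace G₁] [TopologicalSpace G₂] [TopologicalSpace G₃] [TopologicalSpace G₄]

/-- **`(G₁ × G₂) × (G₃ × G₄) ≃ₜ* (G₁ × G₃) × (G₂ × G₄)`** — Mathlib's `MulEquiv.prodProdProdComm` and
`Homeomorph.prodProdProdComm` as one topological-group isomorphism (e.g.
`(G₂(𝔸_∞) × G₂(𝔸_f)) × (G₁(𝔸_∞) × G₁(𝔸_f)) ≅ (G₂ × G₁)(𝔸_∞) × (G₂ × G₁)(𝔸_f)`). [cite: BorelJacquet1979, §4.1] -/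
def ContinuousMulEquiv.prodProdProdComm' : (G₁ × G₂) × G₃ × G₄ ≃ₜ* (G₁ × G₃) × G₂ × G₄ where
  toMulEquiv := MulEquiv.prodProdProdComm G₁ G₂ G₃ G₄
  continuous_toFun := (Homeomorph.prodProdProdComm G₁ G₂ G₃ G₄).continuous
  continuous_invFun := (Homeomorph.prodProdProdComm G₁ G₂ G₃ G₄).symm.continuous

/-- `prodProdProdComm'` swaps the middle factors. [cite: BorelJacquet1979, §4.1] -/
@[simp] theorem ContinuousMulEquiv.prodProdProdComm'_apply (p : (G₁ × G₂) × G₃ × G₄) :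
    ContinuousMulEquiv.prodProdProdComm' G₁ G₂ G₃ G₄ p = ((p.1.1, p.2.1), (p.1.2, p.2.2)) := rfl

/-- Its inverse swaps them back (the same formula). [cite: BorelJacquet1979, §4.1] -/
@[simp] theorem ContinuousMulEquiv.prodProdProdComm'_symm_apply (p : (G₁ × G₃) × G₂ × G₄) :
    (ContinuousMulEquiv.prodProdProdComm' G₁ G₂ G₃ G₄).symm p = ((p.1.1, p.2.1), (p.1.2, p.2.2)) := rfl

end Rider

end Literature.Topology
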